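import Summits.QuantumAdvantage.QuantumAdvantage.Theorems.CharDialTokenDialA
import Summits.QuantumAdvantage.QuantumAdvantage.Theorems.CharDialSegmentMovesD
import HarnessLib

/-!
# CharDial tower — the TOKEN DIAL, part D1: the semantic flip law and multi-form cells (local token pairing, §6–§7)

Cell `decomp-qadv`, lens 6 («barrier-complement carving»), generation 19 (REV1); supports the LOW child
`JLinLowResidual5` (stmt-QuantumAdvantage-27206) and the HIGH child `JLinResidualHigh5` (27207) of the CharDial crux
`WalkHardFJLinOdd` (32604).  Imports the landed part A (`TokenDial.engine` and its §1–§4 vocabulary).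

Parts A–C paired inputs across an adjacent transposition at a pair `(s, t = s+1)` that is DEAD for every cut.  Parts D1/D2/D drop
that restriction: a set `G` of READER cuts may feel the pair (coefficient jump `a_g(s) ≠ a_g(t)` or `s, t ∈ J_g`), cut `t` included.
This file supplies the two inputs of the local engine:

* §6 (semantic flip law, `ringWinU_swap_of_iff`; `flipE`, `flip_pairing`) if at an input `u` every cut OTHER than cut `t` is inert
  under the transposition (`y_g(u^{(st)}) = y_g(u)`), the win bit flips iff the fired-and-off-zero indicator of cut `t` differs
  before/after; the flip set `flipE` pairs off against the win set unconditionally (`2·#WIN + |flipE| ≤ 2·2ⁿ`).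
* §7 (multi-form cells, `cellM` … `cell_le_three_addrM`) on a cell fixing the bits on `O` and the values of `n+1` linear forms, the
  address of cut `t` is equidistributed mod 3 up to `2(2cos(π/(3p)))ⁿ` — the Literature two-moduli lemma
  `TwoModuli.abs_three_mul_card_cell_sub_card_le` with `n + (n+1)` forms ([ChattopadhyayWigderson2009, Lemma 5]; the bound is
  uniform in the number of forms), transported to addresses by the reflection of part A2.
0 sorry.
-/

set_option autoImplicit false

namespace Summit.QuantumAdvantage.AdviceFreeQNC0.JLinPeel.TokenDial

open Finset SegMove

variable {n : ℕ}

/-! ### §6 the semantic flip set and the general win-flip law -/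

/-- the swapped bit at `t`. -/
theorem swap_apply_t (u : Fin n → Bool) (s t : Fin n) (hst : t.val = s.val + 1) :
    segCompl u s.val (s.val + 2) t = !u t := by
  simp [segCompl_apply, show s.val ≤ t.val ∧ t.val < s.val + 2 from ⟨by omega, by omega⟩]

/-- bits outside the pair are untouched. -/
theorem swap_apply_of_ne (u : Fin n → Bool) (s t : Fin n) (hst : t.val = s.val + 1) (j : Fin n) (hjs : j ≠ s)
    (hjt : j ≠ t) : segCompl u s.val (s.val + 2) j = u j := by
  have hj : ¬ (s.val ≤ j.val ∧ j.val < s.val + 2) := by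
    rintro ⟨h1, h2⟩
    rcases Nat.lt_or_ge j.val (s.val + 1) with h | h
    · exact hjs (Fin.ext (by omega))
    · exact hjt (Fin.ext (by omega))
  rw [segCompl_apply, if_neg hj]

/-- addresses are residues. -/
theorem addr_lt_three (c : ℕ) (u : Fin n → Bool) (g : ℕ) : addr c u g < 3 := by
  rw [addr_eq]; exact Nat.mod_lt _ (by norm_num)

/-- **the flip set** of the pair `(s, t)`: swap-set inputs at which the win bit flips under the transposition. -/
def flipE (c : ℕ) (y : Fin (n + 1) → (Fin n → Bool) → Bool) (s t : Fin n) : Finset (Fin n → Bool) :=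
  univ.filter fun u => u s ≠ u t ∧ ringWinU c y (segCompl u s.val (s.val + 2)) ≠ ringWinU c y u

/-- membership in `flipE`. -/
theorem mem_flipE (c : ℕ) (y : Fin (n + 1) → (Fin n → Bool) → Bool) (s t : Fin n) (u : Fin n → Bool) :
    u ∈ flipE c y s t ↔ u s ≠ u t ∧ ringWinU c y (segCompl u s.val (s.val + 2)) ≠ ringWinU c y u := by
  unfold flipE; rw [mem_filter]; simp only [mem_univ, true_and]

/-- **pairing inequality (semantic, unconditional).** `2·#WIN + |flipE| ≤ 2·2ⁿ`. -/
theorem flip_pairing (c : ℕ) (y : Fin (n + 1) → (Fin n → Bool) → Bool) (s t : Fin n) (hst : t.val = s.val + 1) :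
    2 * (univ.filter fun u : Fin n → Bool => ringWinU c y u = true).card + (flipE c y s t).card ≤ 2 * 2 ^ n := by
  refine pairing_law c y (flipE c y s t) (fun u => segCompl u s.val (s.val + 2)) ?_ ?_ ?_
  · intro u hu
    obtain ⟨hne, hflip⟩ := (mem_flipE c y s t u).1 hu
    rw [mem_flipE]
    refine ⟨swap_ne u s t hst hne, ?_⟩
    rw [segCompl_segCompl]
    exact hflip.symm
  · intro u _; exact segCompl_segCompl u _ _
  · intro u hu
    exact ((mem_flipE c y s t u).1 hu).2

/-- **LAW (win flip, general).** if every cut other than cut `t` is inert at `u` under the transposition, the win bit flips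
iff the fired-and-off-zero indicator of cut `t` differs before/after. -/
theorem ringWinU_swap_of_iff (c : ℕ) (y : Fin (n + 1) → (Fin n → Bool) → Bool) (u : Fin n → Bool) (s t : Fin n)
    (hst : t.val = s.val + 1) (hne : u s ≠ u t)
    (hinert : ∀ g : Fin (n + 1), g ≠ cut t → y g (segCompl u s.val (s.val + 2)) = y g u)
    (hx : (y (cut t) u = true ∧ addr c u t.val ≠ 0) ↔
      ¬ (y (cut t) (segCompl u s.val (s.val + 2)) = true ∧ addr c (segCompl u s.val (s.val + 2)) t.val ≠ 0)) :
    ringWinU c y (segCompl u s.val (s.val + 2)) ≠ ringWinU c y u := by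
  have hrest : ((univ.erase (cut t)).filter fun g : Fin (n + 1) =>
        y g (segCompl u s.val (s.val + 2)) = true ∧ (c + g.val + walkExp (segCompl u s.val (s.val + 2)) g.val) % 3 ≠ 0)
      = (univ.erase (cut t)).filter fun g : Fin (n + 1) => y g u = true ∧ (c + g.val + walkExp u g.val) % 3 ≠ 0 := by
    refine filter_congr fun g hg => ?_
    have hg' : g.val ≠ s.val + 1 := fun h => (ne_of_mem_erase hg) (Fin.ext (by rw [cut_val]; omega))
    rw [hinert g (ne_of_mem_erase hg), walkExp_swap_of_ne u s t hst hne hg']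
  have e1 := flc_split c y (segCompl u s.val (s.val + 2)) (cut t)
  have e2 := flc_split c y u (cut t)
  rw [hrest] at e1
  simp only [cut_val] at e1 e2
  rw [addr_eq, addr_eq] at hx
  rw [ne_eq, ringWinU_eq_decide, ringWinU_eq_decide]
  intro heq
  have hiff : (flc c y (segCompl u s.val (s.val + 2)) % 2 = 1) ↔ (flc c y u % 2 = 1) := by
    simpa using congrArg (fun b => b = true) heq
  split_ifs at e1 e2 with hA hB hB
  · exact (hx.1 hB) hA
  · omega
  · omega
  · exact hB (hx.2 hA)

/-! ### §7 multi-form cells: a junta pattern and the values of `n+1` linear forms -/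

section MCells

variable {p : ℕ} [hp : Fact p.Prime]

/-- the MULTI-FORM CELL: inputs agreeing with `β` on `O` whose `g`-th form is `V g` for every `g`. -/
def cellM (O : Finset (Fin n)) (β : Fin n → Bool) (A : Fin (n + 1) → Fin n → ZMod p) (V : Fin (n + 1) → ZMod p) :
    Finset (Fin n → Bool) :=
  univ.filter fun w => (∀ j ∈ O, w j = β j) ∧ ∀ g, form (A g) w = V g

omit hp in
/-- membership in a multi-form cell. -/
theorem mem_cellM (O : Finset (Fin n)) (β : Fin n → Bool) (A : Fin (n + 1) → Fin n → ZMod p) (V : Fin (n + 1) → ZMod p)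
    (w : Fin n → Bool) : w ∈ cellM O β A V ↔ (∀ j ∈ O, w j = β j) ∧ ∀ g, form (A g) w = V g := by
  unfold cellM; rw [mem_filter]; simp only [mem_univ, true_and]

/-- the forms presenting a multi-form cell to the Literature lemma: coordinate indicators on `O` (indices `< n`), then the
`n+1` forms `A`. -/
def lamM (O : Finset (Fin n)) (A : Fin (n + 1) → Fin n → ZMod p) : Fin (n + (n + 1)) → Fin n → ZMod p := fun j i =>
  if h : j.val < n then (if i = ⟨j.val, h⟩ then (if (⟨j.val, h⟩ : Fin n) ∈ O then 1 else 0) else 0)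
  else A ⟨j.val - n, by have := j.isLt; omega⟩ i

/-- the cell label. -/
def vlM (O : Finset (Fin n)) (β : Fin n → Bool) (V : Fin (n + 1) → ZMod p) : Fin (n + (n + 1)) → ZMod p := fun j =>
  if h : j.val < n then (if (⟨j.val, h⟩ : Fin n) ∈ O ∧ β ⟨j.val, h⟩ = true then 1 else 0)
  else V ⟨j.val - n, by have := j.isLt; omega⟩

/-- a coordinate-indicator form evaluates to the (masked) bit. -/
theorem sum_lamM_low (O : Finset (Fin n)) (A : Fin (n + 1) → Fin n → ZMod p) (w : Fin n → Bool)
    (j' : Fin (n + (n + 1))) (h : j'.val < n) :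
    (∑ i : Fin n, if w i = true then lamM O A j' i else 0) =
      if (⟨j'.val, h⟩ : Fin n) ∈ O ∧ w ⟨j'.val, h⟩ = true then 1 else 0 := by
  unfold lamM
  simp only [dif_pos h]
  rw [sum_indicator]
  by_cases hO : (⟨j'.val, h⟩ : Fin n) ∈ O <;> simp [hO]

/-- a high-index form of `lamM` evaluates to the corresponding form of `A`. -/
theorem sum_lamM_high (O : Finset (Fin n)) (A : Fin (n + 1) → Fin n → ZMod p) (w : Fin n → Bool)
    (j' : Fin (n + (n + 1))) (h : ¬ j'.val < n) :
    (∑ i : Fin n, if w i = true then lamM O A j' i else 0) = form (A ⟨j'.val - n, by have := j'.isLt; omega⟩) w := by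
  unfold lamM form
  simp only [dif_neg h]

/-- the low-index labels. -/
theorem vlM_low (O : Finset (Fin n)) (β : Fin n → Bool) (V : Fin (n + 1) → ZMod p) (j' : Fin (n + (n + 1)))
    (h : j'.val < n) : vlM O β V j' = if (⟨j'.val, h⟩ : Fin n) ∈ O ∧ β ⟨j'.val, h⟩ = true then 1 else 0 := by
  unfold vlM; simp only [dif_pos h]

/-- the high-index labels. -/
theorem vlM_high (O : Finset (Fin n)) (β : Fin n → Bool) (V : Fin (n + 1) → ZMod p) (j' : Fin (n + (n + 1)))
    (h : ¬ j'.val < n) : vlM O β V j' = V ⟨j'.val - n, by have := j'.isLt; omega⟩ := by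
  unfold vlM; simp only [dif_neg h]

/-- the forms `lamM` with label `vlM` cut out exactly the multi-form cell. -/
theorem forms_eq_iffM (O : Finset (Fin n)) (β : Fin n → Bool) (A : Fin (n + 1) → Fin n → ZMod p)
    (V : Fin (n + 1) → ZMod p) (w : Fin n → Bool) :
    ((fun j => ∑ i, if w i then lamM O A j i else 0) = vlM O β V) ↔
      ((∀ j ∈ O, w j = β j) ∧ ∀ g, form (A g) w = V g) := by
  haveI : Fact (1 < p) := ⟨hp.out.one_lt⟩
  constructor
  · intro H
    refine ⟨fun j hj => ?_, fun g => ?_⟩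
    · have hjn : (⟨j.val, by have := j.isLt; omega⟩ : Fin (n + (n + 1))).val < n := j.isLt
      have h := congrFun H ⟨j.val, by have := j.isLt; omega⟩
      have ej : (⟨j.val, j.isLt⟩ : Fin n) = j := rfl
      rw [sum_lamM_low O A w _ hjn, vlM_low O β V _ hjn] at h
      simp only [ej, hj, true_and] at h
      revert h
      rcases Bool.eq_false_or_eq_true (w j) with h1 | h1 <;>
        rcases Bool.eq_false_or_eq_true (β j) with h2 | h2 <;> simp [h1, h2]
    · have hgn : ¬ (⟨n + g.val, by have := g.isLt; omega⟩ : Fin (n + (n + 1))).val < n := by simp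
      have h := congrFun H ⟨n + g.val, by have := g.isLt; omega⟩
      rw [sum_lamM_high O A w _ hgn, vlM_high O β V _ hgn] at h
      have eg : (⟨(⟨n + g.val, by have := g.isLt; omega⟩ : Fin (n + (n + 1))).val - n,
          by have := g.isLt; omega⟩ : Fin (n + 1)) = g := Fin.ext (by simp)
      rw [eg] at h
      exact h
  · rintro ⟨hO, hf⟩
    funext j'
    by_cases h : j'.val < n
    · rw [sum_lamM_low O A w j' h, vlM_low O β V j' h]
      by_cases hjO : (⟨j'.val, h⟩ : Fin n) ∈ O
      · rw [hO _ hjO]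
      · simp [hjO]
    · rw [sum_lamM_high O A w j' h, vlM_high O β V j' h]
      exact hf _

/-- **LAW (two-moduli equidistribution on multi-form cells; the Literature input).** on every multi-form cell the Hamming weight
mod 3 is within `2(2cos(π/(3p)))ⁿ` of uniform (`3 ∤ p`): [ChattopadhyayWigderson2009, Lemma 5] =
`TwoModuli.abs_three_mul_card_cell_sub_card_le` with `n + (n+1)` forms. -/
theorem third_on_cellsM (hp3 : p ≠ 3) (O : Finset (Fin n)) (β : Fin n → Bool) (A : Fin (n + 1) → Fin n → ZMod p)
    (V : Fin (n + 1) → ZMod p) (r : ZMod 3) :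
    |3 * (((cellM O β A V).filter fun w => ((wt w : ℕ) : ZMod 3) = r).card : ℝ) - ((cellM O β A V).card : ℝ)|
      ≤ 2 * (2 * Real.cos (Real.pi / (3 * p))) ^ n := by
  classical
  haveI : NeZero p := ⟨hp.out.ne_zero⟩
  have hcop : p.Coprime 3 := (Nat.coprime_primes hp.out Nat.prime_three).mpr hp3
  have h := Literature.Computability.MetaComplexity.TwoModuli.abs_three_mul_card_cell_sub_card_le
    (ι := Fin n) hcop (lamM O A) (vlM O β V) r
  have e1 : (univ.filter fun u : Fin n → Bool =>
        ((univ.filter fun i => u i = true).card : ZMod 3) = r ∧ (fun j => ∑ i, if u i then lamM O A j i else 0) = vlM O β V)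
      = (cellM O β A V).filter fun w => ((wt w : ℕ) : ZMod 3) = r := by
    unfold cellM
    rw [filter_filter]
    refine filter_congr fun w _ => ?_
    rw [forms_eq_iffM]
    unfold wt
    tauto
  have e2 : (univ.filter fun u : Fin n → Bool => (fun j => ∑ i, if u i then lamM O A j i else 0) = vlM O β V)
      = cellM O β A V := by
    unfold cellM
    exact filter_congr fun w _ => forms_eq_iffM O β A V w
  rw [e1, e2, Fintype.card_fin] at h
  exact h

/-- the reflected forms. -/
def reflAM (A : Fin (n + 1) → Fin n → ZMod p) (t : Fin n) : Fin (n + 1) → Fin n → ZMod p := fun g => reflA (A g) t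

/-- the reflected labels. -/
def shiftV (A : Fin (n + 1) → Fin n → ZMod p) (V : Fin (n + 1) → ZMod p) (t : Fin n) : Fin (n + 1) → ZMod p := fun g =>
  V g - ∑ i : Fin n, if i.val < t.val then A g i else 0

/-- a multi-form cell is reflected onto a multi-form cell. -/
theorem cell_reflectM (O : Finset (Fin n)) (β : Fin n → Bool) (A : Fin (n + 1) → Fin n → ZMod p) (V : Fin (n + 1) → ZMod p)
    (t : Fin n) : (cellM O β A V).card = (cellM O (reflB β t) (reflAM A t) (shiftV A V t)).card := by
  unfold cellM reflAM shiftV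
  rw [card_filter_reflect t]
  congr 1
  refine filter_congr fun w _ => ?_
  simp only [reflect_apply_eq_iff, form_reflect, eq_sub_iff_add_eq]

/-- an address class of a multi-form cell is reflected onto a weight class of a multi-form cell. -/
theorem cell_addr_reflectM (c : ℕ) (O : Finset (Fin n)) (β : Fin n → Bool) (A : Fin (n + 1) → Fin n → ZMod p)
    (V : Fin (n + 1) → ZMod p) (t : Fin n) (rr : ℕ) (hrr : rr < 3) :
    ((cellM O β A V).filter fun u => addr c u t.val = rr).card =
      ((cellM O (reflB β t) (reflAM A t) (shiftV A V t)).filter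
        fun w => ((wt w : ℕ) : ZMod 3) = (rr : ZMod 3) - (c : ZMod 3)).card := by
  unfold cellM reflAM shiftV
  rw [filter_filter, filter_filter, card_filter_reflect t]
  congr 1
  refine filter_congr fun w _ => ?_
  have hmod : (c + wt w) % 3 = rr ↔ ((wt w : ℕ) : ZMod 3) + (c : ZMod 3) = (rr : ZMod 3) := by
    rw [← Nat.cast_add, add_comm (wt w) c, ZMod.natCast_eq_natCast_iff', Nat.mod_eq_of_lt hrr]
  simp only [reflect_apply_eq_iff, form_reflect, eq_sub_iff_add_eq, addr_eq_reflect, segCompl_segCompl, hmod]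

/-- **COROLLARY (one-sided).** every address class of cut `t` on a multi-form cell holds at least a third of the cell, up to
`2(2cos(π/(3p)))ⁿ`. -/
theorem cell_le_three_addrM (hp3 : p ≠ 3) (c : ℕ) (O : Finset (Fin n)) (β : Fin n → Bool)
    (A : Fin (n + 1) → Fin n → ZMod p) (V : Fin (n + 1) → ZMod p) (t : Fin n) (rr : ℕ) (hrr : rr < 3) :
    ((cellM O β A V).card : ℝ) ≤ 3 * (((cellM O β A V).filter fun u => addr c u t.val = rr).card : ℝ)
      + 2 * (2 * Real.cos (Real.pi / (3 * p))) ^ n := by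
  rw [cell_reflectM O β A V t, cell_addr_reflectM c O β A V t rr hrr]
  have h := third_on_cellsM hp3 O (reflB β t) (reflAM A t) (shiftV A V t) ((rr : ZMod 3) - (c : ZMod 3))
  have := (abs_le.mp h).1
  linarith

end MCells

end Summit.QuantumAdvantage.AdviceFreeQNC0.JLinPeel.TokenDial
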